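import Summits.BirchSwinnertonDyer.BirchSwinnertonDyer.Theorems.SignedLowerHalvesKobayashiLowerHalfLargeImageKuriharaRigidityBindersOfFacts
import Summits.BirchSwinnertonDyer.BirchSwinnertonDyer.Theorems.SignedLowerHalvesKobayashiLowerHalfLargeImageKuriharaRigidityFacts
import HarnessLib

/-!
# Line `kurihara_rigidity` of crux `KobayashiLowerHalfLargeImage` (item stmt-BirchSwinnertonDyer-19001, route
# `SignedLowerHalves`) IN ONE THEOREM, FINEST TRUST BASE: the crux BY NAME modulo {Kim 2026 Thm. 1.11 (1) ⟹ (3)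
# on Kato's objects, Castella–Sano Thm. 1 (i) ⟹ (ii) on Kato's objects (PREPRINT), Kobayashi Thm. 1.2, the period
# unit} and the line's open statements — Kobayashi's Thm. 7.4 being a KERNEL theorem (cell `bsd-ssimc`, seat
# `bsd-line-slh-p1-w2`; `--supports … --as helper`)

The lead's composition `kobayashiLowerHalfLargeImage_of_kim111_of_castellaSano_OPEN` (file
`…KuriharaRigidityFacts`, p607505) reaches the crux BY NAME from the composite binders
`Kim2026_thm111_via_kobayashi74` («Kim 1.11 ∘ Kobayashi 7.4») and `CastellaSano2026_thm1_via_kobayashi74_OPEN`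
(«CS Thm 1 ∘ Kobayashi 7.4»), the period fact, the two halves of Kim's Conjecture 1.10 on X7 and the `p = 3`
residue. This seat derived both composite binders (`…BindersOfFacts`, p608428: `kim2026_thm111_via_kobayashi74_of_facts`,
`castellaSano2026_thm1_via_kobayashi74_OPEN_of_facts`) from the statements of Kim's and Castella–Sano's theorems ON
KATO'S PINNED OBJECTS (`Kim2026.thm111_katoMainIdentity_of_kuriharaNumber_ne_zero`, p607903, PUBLISHED;
`CastellaSano2026.thm1_katoMainIdentity_of_kimTamagawaDefect_OPEN`, p607905, PREPRINT claim), Kobayashi Thm. 1.2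
and the period unit, through Kobayashi's Thm. 7.4 (ii) at `η = 1` RUN IN THE KERNEL (`…KuriharaRigidityThm74`,
p607446). THIS FILE is the composition of the two: the crux BY NAME with the Kobayashi-7.4 step no longer a
hypothesis. Two variants: with both halves of Kim's Conjecture 1.10 displayed (`…_of_katoFacts_OPEN`), and with
the `≥` half read from Castella–Sano §2 (`…_of_katoFacts_readings_OPEN`, the lead's
`CastellaSano2026_sec2_tamagawaDefectGe_implicit_OPEN`).

TRUST BASE along this line, after this file (numbers, not adjectives): PUBLISHED named facts ×3 (Kim Thm. 1.11 on
the package; Kobayashi Thm. 1.2; the period unit Greenberg–Vatsal/Mazur) + PREPRINT claims ×1 (CS Thm. 1 on the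
package) [+1 PREPRINT reading for the `≥` half in the second variant] + OPEN statements: the `≤` half of Kim's
Conjecture 1.10 for the newform of every X7 ∧ ¬CM ∧ `a_p = 0` ∧ Surj pair at `p ≥ 5` (one non-vanishing Kurihara
number per pair), the `≥` half (first variant), the crux at `p = 3`. HONEST FRAMING (cell `bsd-ssimc`,
D-0036/D-0074): TOOL THEOREMS ONLY; CONDITIONAL on the displayed hypotheses; the class-wide crux, the line's HARD
stub and the route are NOT closed; nothing is booked; BSD is not proved by any of this.
`--supports stmt-BirchSwinnertonDyer-19001 --as helper`.

References: [Kim2022StructureSelmer] Thm. 1.11, Conj. 1.10; [CastellaSano2026] Thm. 1, §2; [Kobayashi2003] Thm.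
1.2, Thm. 7.4 (p. 13), Conjecture (p. 2); [GreenbergVatsal2000] §3 Rem. 3.4; [Mazur1978] Cor. 4.1.
-/

set_option autoImplicit false
-- single-problem summit (D-0017): the doubled namespace component is by design
set_option linter.dupNamespace false

noncomputable section

open scoped Classical MatrixGroups ModularForm

open CongruenceSubgroup Field WeierstrassCurve Literature.NumberTheory.EllipticCurves
  Literature.NumberTheory.EllipticCurves.ModularForms Literature.NumberTheory.GaloisRepresentations
  Literature.NumberTheory.EllipticCurves.Rank1Residual Literature.NumberTheory.EllipticCurves.Rank1Residual.Typed
  Summit.BirchSwinnertonDyer.Rank1Residual.Supersingular Summit.BirchSwinnertonDyer.Rank1Residual.X4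

namespace Summit.BirchSwinnertonDyer.BirchSwinnertonDyer.Theorems.KuriharaRigidity

/-- **THE LINE `kurihara_rigidity`, KOBAYASHI 7.4 IN THE KERNEL.** The crux `KobayashiLowerHalfLargeImage` BY
NAME from: `Kim2026.thm111_katoMainIdentity_of_kuriharaNumber_ne_zero` (`hKim`; Kim AJM 2026 Thm. 1.11 (1) ⟹ (3)
read on the `η = 1` package — PUBLISHED), `CastellaSano2026.thm1_katoMainIdentity_of_kimTamagawaDefect_OPEN`
(`hCS`; Castella–Sano Thm. 1 (i) ⟹ (ii) on the package — PREPRINT claim, never a theorem),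
`Kobayashi2003.thm12_signedSelmerDual_finite_torsion` (`h12`; PUBLISHED), `realPeriodRat_eq_unit_mul_plusPeriod`
(`h5`; PUBLISHED), the `≤` half (`hLe`) and the `≥` half (`hGe`) of Kim's Conjecture 1.10 for the newform of every
X7 ∧ ¬CM ∧ `a_p = 0` ∧ Surj pair at `p ≥ 5`, and the crux's own conclusion at `p = 3` (`h3`). = the lead's
`kobayashiLowerHalfLargeImage_of_kim111_of_castellaSano_OPEN` with its two composite binders DISCHARGED by
`kim2026_thm111_via_kobayashi74_of_facts` / `castellaSano2026_thm1_via_kobayashi74_OPEN_of_facts` (Kobayashi Thm.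
7.4 (ii) at `η = 1` proved in `…KuriharaRigidityThm74`). CONDITIONAL; closes nothing; BSD is not proved.
[cite: Kim2022StructureSelmer, Thm. 1.11 (1) ⟹ (3) and Conj. 1.10 (PDF p. 8)]
[cite: Kobayashi2003, Thm. 7.4 (p. 13), Thm. 1.2 (p. 2)] [claim: CastellaSano2026, status: under-review] -/
theorem kobayashiLowerHalfLargeImage_of_katoFacts_OPEN
    (hKim : Kim2026.thm111_katoMainIdentity_of_kuriharaNumber_ne_zero)
    (hCS : CastellaSano2026.thm1_katoMainIdentity_of_kimTamagawaDefect_OPEN)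
    (h12 : Kobayashi2003.thm12_signedSelmerDual_finite_torsion)
    (h5 : realPeriodRat_eq_unit_mul_plusPeriod)
    (hLe : ∀ (W : WeierstrassCurve ℚ) [W.IsElliptic] [W.IsGloballyMinimal] (p : ℕ) [Fact p.Prime],
      5 ≤ p → ClassX7 W p → ¬ W.HasCM → W.frobeniusTrace p = 0 → Surj W p →
      ∀ [NeZero (W.conductorNorm ℤ)] (f : CuspForm (Gamma0 (W.conductorNorm ℤ)) 2),
        IsNewformOf W f → KimTamagawaDefectLeAt W p f)
    (hGe : ∀ (W : WeierstrassCurve ℚ) [W.IsElliptic] [W.IsGloballyMinimal] (p : ℕ) [Fact p.Prime],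
      5 ≤ p → ClassX7 W p → ¬ W.HasCM → W.frobeniusTrace p = 0 → Surj W p →
      ∀ [NeZero (W.conductorNorm ℤ)] (f : CuspForm (Gamma0 (W.conductorNorm ℤ)) 2),
        IsNewformOf W f → KimTamagawaDefectGeAt W p f)
    (h3 : ∀ (W : WeierstrassCurve ℚ) [W.IsElliptic] [W.IsGloballyMinimal] (p : ℕ) [Fact p.Prime],
      p = 3 → ClassX7 W p → ¬ W.HasCM → W.frobeniusTrace p = 0 → Surj W p →
      ∃ ε : ℤˣ, KobayashiLowerDivisibility W p ε) :
    Summit.BirchSwinnertonDyer.BirchSwinnertonDyer.Theses.SignedLowerHalves.KobayashiLowerHalfLargeImage :=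
  kobayashiLowerHalfLargeImage_of_kim111_of_castellaSano_OPEN
    (kim2026_thm111_via_kobayashi74_of_facts hKim h12 h5)
    (castellaSano2026_thm1_via_kobayashi74_OPEN_of_facts hCS h12 h5) h5 hLe hGe h3

/-- **The same with the `≥` half read from Castella–Sano §2** (the lead's reading binder
`CastellaSano2026_sec2_tamagawaDefectGe_implicit_OPEN`, `hCSge`; PREPRINT, implicit): the crux BY NAME from
`{hKim, hCS, hCSge, h12, h5}` and the line's open content at `p ≥ 5` = ONE statement, the `≤` half of Kim's
Conjecture 1.10 on the large-image corner of X7 (`hLe`), plus the `p = 3` case (`h3`). = the lead's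
`kobayashiLowerHalfLargeImage_of_kim111_of_castellaSano_readings_OPEN` with the composite binders discharged.
CONDITIONAL; closes nothing; BSD is not proved. [cite: Kim2022StructureSelmer, Thm. 1.11 (1) ⟹ (3) and Conj. 1.10 (PDF p. 8)]
[cite: Kobayashi2003, Thm. 7.4 (p. 13), Thm. 1.2 (p. 2)] [claim: CastellaSano2026, status: under-review] -/
theorem kobayashiLowerHalfLargeImage_of_katoFacts_readings_OPEN
    (hKim : Kim2026.thm111_katoMainIdentity_of_kuriharaNumber_ne_zero)
    (hCS : CastellaSano2026.thm1_katoMainIdentity_of_kimTamagawaDefect_OPEN)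
    (hCSge : CastellaSano2026_sec2_tamagawaDefectGe_implicit_OPEN)
    (h12 : Kobayashi2003.thm12_signedSelmerDual_finite_torsion)
    (h5 : realPeriodRat_eq_unit_mul_plusPeriod)
    (hLe : ∀ (W : WeierstrassCurve ℚ) [W.IsElliptic] [W.IsGloballyMinimal] (p : ℕ) [Fact p.Prime],
      5 ≤ p → ClassX7 W p → ¬ W.HasCM → W.frobeniusTrace p = 0 → Surj W p →
      ∀ [NeZero (W.conductorNorm ℤ)] (f : CuspForm (Gamma0 (W.conductorNorm ℤ)) 2),
        IsNewformOf W f → KimTamagawaDefectLeAt W p f)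
    (h3 : ∀ (W : WeierstrassCurve ℚ) [W.IsElliptic] [W.IsGloballyMinimal] (p : ℕ) [Fact p.Prime],
      p = 3 → ClassX7 W p → ¬ W.HasCM → W.frobeniusTrace p = 0 → Surj W p →
      ∃ ε : ℤˣ, KobayashiLowerDivisibility W p ε) :
    Summit.BirchSwinnertonDyer.BirchSwinnertonDyer.Theses.SignedLowerHalves.KobayashiLowerHalfLargeImage :=
  kobayashiLowerHalfLargeImage_of_kim111_of_castellaSano_readings_OPEN
    (kim2026_thm111_via_kobayashi74_of_facts hKim h12 h5)
    (castellaSano2026_thm1_via_kobayashi74_OPEN_of_facts hCS h12 h5) hCSge h5 hLe h3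

end Summit.BirchSwinnertonDyer.BirchSwinnertonDyer.Theorems.KuriharaRigidity

end
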